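import Mathlib.Analysis.Complex.LocallyUniformLimit
import Summits.QuantumFields.BalabanUV.T4Continuum.Spine.NE1p.DressedSmallFieldAllowance

/-!
# T⁴ programme, spine estimate NE1′ (node O3b/H2) — THE POLYMER-SERIES FORM of the small-field allowance: termwise analyticity +
# a summable uniform majorant ⇒ the dressed output is analytic and bounded on the disc (Weierstrass), termwise differentiation in the
# source is LEGITIMATE, and the regeneration ∕ μ-part bounds of `DressedSmallFieldAllowance` follow from PER-TERM data

Cell `pub-balaban`, sub-cell `t4`, BINDER-OWNERS row NE1′; owner lineage t4-ne1p-p1 (PROVER seat P1), generation 25; ADDITIVE — imports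
`Mathlib.Analysis.Complex.LocallyUniformLimit` and `Spine/NE1p/DressedSmallFieldAllowance` (p218876) ONLY; THEOREMS ONLY.

WHY THIS FILE.  `DressedSmallFieldAllowance.regen_le_of_slack` ∕ `muPart_norm_le` take as binder «the dressed OUTPUT `E` is analytic on
the disc and bounded by `M` there» — the cell's UNPRINTED μ∕strength-extension of [Balaban1988RGII] (2.14)–(2.15)∕(2.38)–(2.41)
(t4-ref2 C-t4r2-340 (n1)∕(n3); T4-DAG v32 §8 Q42).  Print's output is a SERIES: (2.12)∕(2.13) p. 14 «E^{(k+1)} = Σ_n (1/n!) Σ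
ρ^T(Z₁,…,Z_n)H(Z₁)⋯H(Z_n)», with per-activity bounds (2.38) and the summed bound (2.41) obtained «repeat[ing] all the considerations
and bounds of the paper [26]» (= Cammarota, CMP 85 (1982) — B12 ref. 26, HELD `paper:doi-10-1007-bf01403502`) — LOCI, TYPE only.  So
the honest shape of the extension is PER TERM: (E1) each term of the series is analytic in the parameter on the disc (from the
analyticity of potentials ∕ observable in (𝐔,𝐉,μ) — (F10) p. 15 TYPE); (E2) each term is bounded on the disc by a majorant `u_i`
INDEPENDENT of the parameter (Lemma 3's bound with the potential smallness `ε₁ ↦ ε₁ + μ₁b + σ` — (2.15) depends on the potential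
only through «exp[Σ|τ(Y)||V_k(Y,B)|]»); (E3) `Σ u_i = M` (the cluster-expansion summation, [26]'s TYPE).  This file proves, by Mathlib's
Weierstrass theorems (`Complex.differentiableOn_tsum_of_summable_norm`, `Complex.hasSum_deriv_of_summable_norm`, `tsum_of_norm_bounded`
BY NAME), that (E1)–(E3) give the OUTPUT binder — and that the owner's R8 phrase «linear response = termwise d/dμ of a convergent
activity series» is then a THEOREM (the derivative of the sum IS the sum of the derivatives), not a heuristic:

* §1 `series_analytic_bounded` — (E1)+(E2)+(E3) ⇒ `Σ' H_i` analytic on the disc and `‖Σ' H_i(s)‖ ≤ M` there.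
* §2 `regen_le_of_termwise` — R8∕(w5) from per-term data: `‖Σ' H_i(1) − Σ' H_i(0)‖ ≤ (2M/ε)·σ` (`regen_le_of_slack` BY NAME);
  `muPart_norm_le_of_termwise` — the observable-attached part `≤ 2Mμ₀/μ₁` on the strict sub-window (`muPart_norm_le_of_window` BY NAME).
* §3 `linearResponse_termwise` — on the strict sub-window the derivative of the output EXISTS as the convergent SUM of the termwise
  derivatives (`HasSum (fun i => deriv (H i) μ) (deriv (Σ' H_i) μ)`) and is `≤ 2M/(μ₁ − μ₀)` (`muDeriv_norm_le_of_window` BY NAME).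

HONEST FRAMING.  Textbook complex analysis over SHAPES (index type, terms, majorant are binders); it relocates the UNPRINTED extension
from «the output» to «each term + a parameter-free summable majorant», which is where print's own structure ((2.15)'s dependence on
the potential through its sup only; [26]'s summation) makes it a parameter substitution — still the CELL's claim for Bałaban's dressed
activities, asserted here for NOTHING.  NE1′ NOT printed, NOT proved; 0 leaves instantiated; spine PROVED 0∕9.  Rung (B)+1 on ONE finite
four-torus — NOT infinite volume, NOT a mass gap, NOT OS on ℝ⁴, NOT Clay.  HONEST DEPENDENCY: continuum YM on T⁴ ⇐ BetaPertH ∧ nine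
spine estimates (0/9 proved); BetaPertH ⇐ (D1) ∧ (D4) ∧ CAP+tail; G-an2-4 gates asym, D1 and NE2/3/4.
-/

noncomputable section

namespace Summit.QuantumFields.BalabanUV.T4Continuum.NE1p.DressedSmallFieldSeries

open Metric Set Complex
open Summit.QuantumFields.BalabanUV.T4Continuum.NE1p.DressedSmallFieldAllowance

variable {F : Type*} [NormedAddCommGroup F] [NormedSpace ℂ F] [CompleteSpace F] {ι : Type*}

/-! ## §1 Termwise analyticity + summable uniform majorant ⇒ analytic bounded output -/

/-- **(E1)+(E2)+(E3) ⇒ THE OUTPUT BINDER** [folklore — Weierstrass]: terms `H i` analytic on the disc `ball c R`, bounded there by a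
parameter-free majorant `u i` with `HasSum u M` ⇒ the series `s ↦ Σ' H i s` is analytic on the disc and bounded by `M` there. -/
theorem series_analytic_bounded {H : ι → ℂ → F} {u : ι → ℝ} {c : ℂ} {R M : ℝ} (hu : HasSum u M)
    (hH : ∀ i, DifferentiableOn ℂ (H i) (ball c R)) (hle : ∀ i, ∀ s ∈ ball c R, ‖H i s‖ ≤ u i) :
    DifferentiableOn ℂ (fun s => ∑' i, H i s) (ball c R) ∧ ∀ s ∈ ball c R, ‖∑' i, H i s‖ ≤ M :=
  ⟨differentiableOn_tsum_of_summable_norm hu.summable hH isOpen_ball (fun i s hs => hle i s hs),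
    fun s hs => tsum_of_norm_bounded hu (fun i => hle i s hs)⟩

/-! ## §2 The regeneration constant and the μ-part from per-term data -/

/-- **R8∕(w5) FROM PER-TERM DATA** [folklore]: terms analytic on `|s| < ε/σ` and bounded by a parameter-free majorant summing to `M`;
`0 < σ < ε` ⇒ the family-sourced part of the output obeys `‖Σ' H i 1 − Σ' H i 0‖ ≤ (2M/ε)·σ` (`regen_le_of_slack` BY NAME). -/
theorem regen_le_of_termwise {H : ι → ℂ → F} {u : ι → ℝ} {ε σ M : ℝ} (hσ : 0 < σ) (hσε : σ < ε)
    (hu : HasSum u M) (hH : ∀ i, DifferentiableOn ℂ (H i) (ball 0 (ε / σ)))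
    (hle : ∀ i, ∀ s ∈ ball (0 : ℂ) (ε / σ), ‖H i s‖ ≤ u i) :
    ‖(∑' i, H i 1) - ∑' i, H i 0‖ ≤ 2 * M / ε * σ := by
  obtain ⟨hd, hM⟩ := series_analytic_bounded hu hH hle
  exact regen_le_of_slack (E := fun s => ∑' i, H i s) hσ hσε hd hM

/-- **THE OBSERVABLE-ATTACHED PART FROM PER-TERM DATA** [folklore]: terms analytic on `|μ| < μ₁` with a parameter-free majorant
summing to `M ≥ 0`; on the strict sub-window `|μ| ≤ μ₀ < μ₁`: `‖Σ' H i μ − Σ' H i 0‖ ≤ 2M·μ₀/μ₁` (`muPart_norm_le_of_window` BY NAME). -/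
theorem muPart_norm_le_of_termwise {H : ι → ℂ → F} {u : ι → ℝ} {μ₁ μ₀ M : ℝ} {μ : ℂ} (hu : HasSum u M) (hM0 : 0 ≤ M)
    (hH : ∀ i, DifferentiableOn ℂ (H i) (ball 0 μ₁)) (hle : ∀ i, ∀ s ∈ ball (0 : ℂ) μ₁, ‖H i s‖ ≤ u i)
    (h01 : μ₀ < μ₁) (hμ : ‖μ‖ ≤ μ₀) :
    ‖(∑' i, H i μ) - ∑' i, H i 0‖ ≤ 2 * M * μ₀ / μ₁ := by
  obtain ⟨hd, hM⟩ := series_analytic_bounded hu hH hle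
  exact muPart_norm_le_of_window (E := fun s => ∑' i, H i s) hd hM hM0 h01 hμ

/-! ## §3 Termwise differentiation in the source is legitimate, with the Cauchy bound -/

/-- **LINEAR RESPONSE = THE SUM OF THE TERMWISE RESPONSES** [folklore — Weierstrass ∕ Cauchy]: under (E1)–(E3) on `|μ| < μ₁`, at
every point of the strict sub-window `|μ| ≤ μ₀ < μ₁` the derivative of the output EXISTS as the convergent sum of the termwise
derivatives, and it is `≤ 2M/(μ₁ − μ₀)` (`Complex.hasSum_deriv_of_summable_norm` + `muDeriv_norm_le_of_window` BY NAME). -/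
theorem linearResponse_termwise {H : ι → ℂ → F} {u : ι → ℝ} {μ₁ μ₀ M : ℝ} {μ : ℂ} (hu : HasSum u M)
    (hH : ∀ i, DifferentiableOn ℂ (H i) (ball 0 μ₁)) (hle : ∀ i, ∀ s ∈ ball (0 : ℂ) μ₁, ‖H i s‖ ≤ u i)
    (h01 : μ₀ < μ₁) (hμ : ‖μ‖ ≤ μ₀) :
    HasSum (fun i => deriv (H i) μ) (deriv (fun s => ∑' i, H i s) μ) ∧
      ‖deriv (fun s => ∑' i, H i s) μ‖ ≤ 2 * M / (μ₁ - μ₀) := by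
  have hμU : μ ∈ ball (0 : ℂ) μ₁ := by
    rw [mem_ball, dist_zero_right]; exact lt_of_le_of_lt hμ h01
  obtain ⟨hd, hM⟩ := series_analytic_bounded hu hH hle
  exact ⟨hasSum_deriv_of_summable_norm hu.summable hH isOpen_ball (fun i s hs => hle i s hs) hμU,
    muDeriv_norm_le_of_window (E := fun s => ∑' i, H i s) hd hM h01 hμ⟩

end Summit.QuantumFields.BalabanUV.T4Continuum.NE1p.DressedSmallFieldSeries

end
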